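import Literature.NumberTheory.EllipticCurves.MazurTateElementKuriharaCoefficient
import Literature.NumberTheory.EllipticCurves.PAdicLFunctionDistributionHoldsProofs
import HarnessLib

/-!
# The norm relation of the Mazur–Tate modular elements `θ̃_f(mℓ) ↦ (a_ℓ - σ_ℓ - σ_ℓ⁻¹) θ̃_f(m)`
# (cell `b2b-bsdres`, team n1011, ROUTE-1 PORT anatomy (P-KIM) = `cells/n1011/skel/T-PORT-1-PKIM.md`
# §3 item (K-ii) "imprimitive characters"; OWNERS row T-PKIM-K12, file F-B; seat p15 GEN 9 — text of
# the p15 GEN 5 γ-bank file written for ROUTE-1 §37.2 (c′), unchanged below the header)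

HONEST FRAMING (cell `b2b-bsdres`, run/shared/lean/b2b/bsd-rank1-residual/, verbatim in every
file): the goal of the cell is to DELETE the COMBINATION-SHAPED residual classes of the
Birch–Swinnerton-Dyer formula for ALL analytic-rank `≤ 1` elliptic curves over `ℚ` — "full BSD
formula for every rank `≤ 1` curve in class `C`" assembled STRICTLY from published theorems — so
that the rank-`≤ 1` remainder becomes exactly the CONSTRUCTION-SHAPED classes, which are TYPED
(missing-input `Prop`s), NOT attempted. This is not "finishing BSD". Team n1011 (N10/N11; ROUTE 1,
the PORT anatomy (P-KIM) of class X4 ∧ `p = 3`): research route on CONSTRUCTION-SHAPED classes;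
prove what is provable now; no claim beyond stated classes; census output = EVIDENCE, never a
Literature fact; RESIDUAL-MAP marks UNCHANGED; nothing is booked by this file. TOOL THEOREMS ONLY:
no definition, no named fact, no `sorry`.

## What

For a weight-`2` cusp form `f` on `Γ₀(N)` the tree's Mazur–Tate modular element is
`θ̃_f(n) = ∑_{a ∈ (ℤ/n)ˣ} [a/n]⁺_f δ_a ∈ ℚ[(ℤ/n)ˣ]` (`modularElement f n`,
`Literature/NumberTheory/EllipticCurves/MazurTateElementKuriharaCoefficient.lean`; `[r]⁺_f =
ratPlusSymbol f r`). This file proves the **norm relation** (K. Ota, *Amer. J. Math.* 140 (2018)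
Prop. 2.3 (1)-type; B. Mazur–J. Tate, *Duke Math. J.* 54 (1987) §1; it is the group-ring form of the
Hecke relation of B. Mazur–J. Tate–J. Teitelbaum, *Invent. Math.* 84 (1986) §I.4 (4.2)): for a prime
`ℓ` with `gcd(ℓ, m) = 1` and `n = m ℓ`,

  `π_{n → m} (θ̃_f(n)) = (a_ℓ - σ_ℓ - σ_ℓ⁻¹) · θ̃_f(m)`  in `ℚ[(ℤ/m)ˣ]`,

where `π_{n → m}` is induced by the reduction `(ℤ/n)ˣ → (ℤ/m)ˣ` (`ZMod.unitsMap`), `σ_ℓ ∈ (ℤ/m)ˣ`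
is the class of `ℓ` (`ZMod.unitOfCoprime ℓ _`) and `a_ℓ` is the Hecke eigenvalue
(`mapDomain_unitsMap_modularElement_of_hecke`). The only analytic input is the Hecke relation of the
rational plus symbols at `ℓ`, `a_ℓ [r]⁺ = ∑_{j mod ℓ} [(r + j)/ℓ]⁺ + [ℓ r]⁺`, taken as the
hypothesis `hHecke`; for a normalised newform with rational Fourier coefficients and `ℓ ∤ N` it is
the TREE THEOREM `ModularForms.intCast_mul_ratPlusSymbol`
(`PAdicLFunctionDistributionProofs.lean`, with `ratCast_ratPlusSymbol_holds` of
`PAdicLFunctionDistributionHoldsProofs.lean`), whence the hypothesis-free twin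
`mapDomain_unitsMap_modularElement`. On the way:

* §A (fibres of `(ℤ/mℓ)ˣ → (ℤ/m)ˣ`): over `a ∈ (ℤ/m)ˣ` the classes `a + m j` (`0 ≤ j < ℓ`) are the
  whole fibre of `ℤ/mℓ → ℤ/m`; exactly one of them, `a + m j₀ = ℓ · (σ_ℓ⁻¹ a)`, is a non-unit;
  `sum_filter_unitsMap_add_eq_sum_fin` packages this as
  `∑_{b ↦ a, b unit} g(b) + g(ℓ (σ_ℓ⁻¹ a)) = ∑_{j < ℓ} g(a + m j)` for any `g : ℕ → M`.
* §B the norm relation, coefficientwise: `∑_{b ↦ a} [b/n]⁺ = a_ℓ [a/m]⁺ - [ℓa/m]⁺ - [ℓ⁻¹a/m]⁺`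
  (the fibre count, the Hecke relation at `r = a/m` with `(a/m + j)/ℓ = (a + m j)/(mℓ)`, and the
  `1`-periodicity of `[·]⁺_f`, `ModularForms.ratPlusSymbol_add_intCast_eq`).

Consumers: `GaloisImage/MazurTateCharacterComponents.lean` (F-C of the row: the same identity evaluated
at a character `φ` of `(ℤ/m)ˣ` — the level-change law of the character components of `θ̃_f` at
characters INDUCED from level `m`, the imprimitive-character half of the PORT item (K-ii)), and the
PORT files PK-4 / PK-6 of `skel/T-PORT-1-PKIM.md` §5 (r1 GEN 41). HONEST LIMITS: the LOWER Taylor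
coefficients at Kolyvagin levels (ROUTE-1 R1-64) are the tree's `MazurTateLowerTaylorCoeff.lean`
(a different proof, via distribution systems) and are NOT re-derived here; nothing about Kato's
Euler factor `P_ℓ(ℓ⁻¹σ_ℓ⁻¹) = 1 − a_ℓ ℓ⁻¹ σ_ℓ⁻¹ + ℓ⁻¹ σ_ℓ⁻²`, which differs from `(a_ℓ − σ_ℓ − σ_ℓ⁻¹)`
by the classical `ℓ ≡ 1` discrepancy (PK-6's bookkeeping). This file closes nothing, books
nothing, moves no mark.

References (context; the statements proved here are elementary consequences of the cited Hecke
relation): [MazurTateTeitelbaum1986Invent] §I.4 (4.2); [Ota2018] Prop. 2.3 (1), §5.1;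
[Kurihara2014] §1.1; [Kim2022StructureSelmer] §3.5; the parent file's module docstring.
-/

noncomputable section

open scoped BigOperators

namespace Summit.BirchSwinnertonDyer.Rank1Residual.GaloisImage

open Literature.NumberTheory.EllipticCurves
open Literature.NumberTheory.EllipticCurves.ModularForms


/-! ### §A. The fibres of `(ℤ/mℓ)ˣ → (ℤ/m)ˣ` -/

section Fibres

variable {m ℓ : ℕ}

/-- For `a < m` and `j < ℓ`, `a + m j < m ℓ`. [folklore] -/
theorem val_add_mul_lt {a j : ℕ} (ha : a < m) (hj : j < ℓ) : a + m * j < m * ℓ := by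
  have h1 : a + m * j < m + m * j := Nat.add_lt_add_right ha _
  have h2 : m + m * j = m * (j + 1) := by ring
  have h3 : m * (j + 1) ≤ m * ℓ := Nat.mul_le_mul_left m hj
  omega

variable [NeZero m]

/-- The class of `a + m j` in `ℤ/mℓ` has least residue `a + m j` (`a < m`, `j < ℓ`). [folklore] -/
theorem val_natCast_add_mul (a : ZMod m) (j : Fin ℓ) :
    (((a.val + m * (j : ℕ) : ℕ) : ZMod (m * ℓ))).val = a.val + m * (j : ℕ) :=
  ZMod.val_natCast_of_lt (val_add_mul_lt (ZMod.val_lt a) j.isLt)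

/-- The class of `a + m j` in `ℤ/mℓ` reduces to `a` in `ℤ/m`. [folklore] -/
theorem cast_natCast_add_mul (a : ZMod m) (j : ℕ) :
    (ZMod.cast (((a.val + m * j : ℕ) : ZMod (m * ℓ))) : ZMod m) = a := by
  rw [ZMod.cast_natCast (dvd_mul_right m ℓ)]
  push_cast
  rw [ZMod.natCast_zmod_val, ZMod.natCast_self, zero_mul, add_zero]

/-- An element `b ∈ ℤ/mℓ` reducing to `a ∈ ℤ/m` has least residue `a + m j` with `j = ⌊b/m⌋ < ℓ`.
[folklore] -/
theorem val_eq_add_mul_div_of_cast_eq [NeZero ℓ] {b : ZMod (m * ℓ)} {a : ZMod m}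
    (h : (ZMod.cast b : ZMod m) = a) :
    b.val = a.val + m * (b.val / m) ∧ b.val / m < ℓ := by
  have hmod : b.val % m = a.val := by
    have h1 : ((b.val : ℕ) : ZMod m) = a := by
      rw [← h, ZMod.cast_eq_val]
    have h2 := congr_arg ZMod.val h1
    rwa [ZMod.val_natCast] at h2
  refine ⟨?_, ?_⟩
  · have := Nat.mod_add_div b.val m
    omega
  · have hb : b.val < m * ℓ := ZMod.val_lt b
    exact Nat.div_lt_of_lt_mul hb

variable (hℓ : ℓ.Prime) (hℓm : ℓ.Coprime m)
include hℓ hℓm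

/-- The distinguished index: for `a ∈ (ℤ/m)ˣ` and `c = σ_ℓ⁻¹ a` (`σ_ℓ` the class of `ℓ`), the
integer `ℓ · c.val < mℓ` reduces to `a` mod `m`, so `ℓ · c.val = a.val + m j₀` with
`j₀ = ⌊ℓ c.val / m⌋ < ℓ`. [folklore] -/
theorem mul_val_inv_mul_eq (a : (ZMod m)ˣ) :
    ℓ * (((ZMod.unitOfCoprime ℓ hℓm)⁻¹ * a : (ZMod m)ˣ) : ZMod m).val =
        (a : ZMod m).val + m * (ℓ * (((ZMod.unitOfCoprime ℓ hℓm)⁻¹ * a : (ZMod m)ˣ) : ZMod m).val / m) ∧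
      ℓ * (((ZMod.unitOfCoprime ℓ hℓm)⁻¹ * a : (ZMod m)ˣ) : ZMod m).val / m < ℓ := by
  set c : (ZMod m)ˣ := (ZMod.unitOfCoprime ℓ hℓm)⁻¹ * a with hc
  have hprod : (ZMod.unitOfCoprime ℓ hℓm : ZMod m) * (c : ZMod m) = a := by
    rw [← Units.val_mul, hc, mul_inv_cancel_left]
  rw [ZMod.coe_unitOfCoprime] at hprod
  have hmod : (ℓ * (c : ZMod m).val) % m = (a : ZMod m).val := by
    have h2 := congr_arg ZMod.val hprod
    rwa [ZMod.val_mul, ZMod.val_natCast, Nat.mod_mul_mod] at h2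
  refine ⟨?_, ?_⟩
  · have := Nat.mod_add_div (ℓ * (c : ZMod m).val) m
    omega
  · have hlt : ℓ * (c : ZMod m).val < m * ℓ := by
      have h1 := ZMod.val_lt (c : ZMod m)
      have h2 := hℓ.pos
      nlinarith
    exact Nat.div_lt_of_lt_mul hlt

/-- `ℓ ∣ a + m j` (`j < ℓ`) iff `j` is the distinguished index `j₀` of `mul_val_inv_mul_eq`.
[folklore] -/
theorem dvd_val_add_mul_iff (a : (ZMod m)ˣ) {j : ℕ} (hj : j < ℓ) :
    ℓ ∣ (a : ZMod m).val + m * j ↔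
      j = ℓ * (((ZMod.unitOfCoprime ℓ hℓm)⁻¹ * a : (ZMod m)ˣ) : ZMod m).val / m := by
  obtain ⟨hj₀, hj₀lt⟩ := mul_val_inv_mul_eq hℓ hℓm a
  set j₀ := ℓ * (((ZMod.unitOfCoprime ℓ hℓm)⁻¹ * a : (ZMod m)ˣ) : ZMod m).val / m with hj₀def
  constructor
  · intro hdvd
    -- `a + m j ≡ 0 ≡ a + m j₀ (mod ℓ)`, cancel `a` and the unit `m`
    have h1 : (a : ZMod m).val + m * j ≡ (a : ZMod m).val + m * j₀ [MOD ℓ] := by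
      rw [← hj₀]
      exact (Nat.modEq_zero_iff_dvd.mpr hdvd).trans
        (Nat.modEq_zero_iff_dvd.mpr (dvd_mul_right ℓ _)).symm
    have h2 : m * j ≡ m * j₀ [MOD ℓ] := Nat.ModEq.add_left_cancel' _ h1
    have h3 : j ≡ j₀ [MOD ℓ] :=
      Nat.ModEq.cancel_left_of_coprime hℓm h2
    exact Nat.ModEq.eq_of_lt_of_lt h3 hj hj₀lt
  · rintro rfl
    rw [← hj₀]
    exact dvd_mul_right ℓ _

/-- The class of `a + m j` in `ℤ/mℓ` is a unit iff `j ≠ j₀` (`a ∈ (ℤ/m)ˣ`, `ℓ` prime, `ℓ ∤ m`).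
[folklore] -/
theorem isUnit_natCast_add_mul_iff (a : (ZMod m)ˣ) {j : ℕ} (hj : j < ℓ) :
    IsUnit (((a : ZMod m).val + m * j : ℕ) : ZMod (m * ℓ)) ↔
      j ≠ ℓ * (((ZMod.unitOfCoprime ℓ hℓm)⁻¹ * a : (ZMod m)ˣ) : ZMod m).val / m := by
  rw [ZMod.isUnit_iff_coprime, Nat.coprime_mul_iff_right]
  have hm : Nat.Coprime ((a : ZMod m).val + m * j) m := by
    rw [Nat.coprime_add_mul_left_left]
    exact ZMod.val_coe_unit_coprime a
  rw [and_iff_right hm, Nat.coprime_comm, Nat.Prime.coprime_iff_not_dvd hℓ,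
    dvd_val_add_mul_iff hℓ hℓm a hj]

variable [NeZero ℓ]

/-- **The fibre sum.** For `a ∈ (ℤ/m)ˣ` (`ℓ` prime, `ℓ ∤ m`) and any `g : ℕ → M`: the sum of
`g` over the least residues of the units `b ∈ (ℤ/mℓ)ˣ` reducing to `a`, plus the value at the one
non-unit `ℓ · (σ_ℓ⁻¹ a).val` of the fibre, is `∑_{j < ℓ} g(a.val + m j)`. [folklore] -/
theorem sum_filter_unitsMap_add_eq_sum_fin {M : Type*} [AddCommMonoid M] (g : ℕ → M)
    (a : (ZMod m)ˣ) :
    (∑ b ∈ Finset.univ.filter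
        (fun b : (ZMod (m * ℓ))ˣ => ZMod.unitsMap (dvd_mul_right m ℓ) b = a),
        g (b : ZMod (m * ℓ)).val) +
      g (ℓ * (((ZMod.unitOfCoprime ℓ hℓm)⁻¹ * a : (ZMod m)ˣ) : ZMod m).val) =
      ∑ j : Fin ℓ, g ((a : ZMod m).val + m * (j : ℕ)) := by
  obtain ⟨hj₀, hj₀lt⟩ := mul_val_inv_mul_eq hℓ hℓm a
  set j₀ : ℕ := ℓ * (((ZMod.unitOfCoprime ℓ hℓm)⁻¹ * a : (ZMod m)ˣ) : ZMod m).val / m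
    with hj₀def
  set S : Finset (ZMod (m * ℓ))ˣ := Finset.univ.filter
    (fun b : (ZMod (m * ℓ))ˣ => ZMod.unitsMap (dvd_mul_right m ℓ) b = a) with hS
  -- the index `⌊b/m⌋ < ℓ` of a unit `b`
  let J : (ZMod (m * ℓ))ˣ → Fin ℓ := fun b =>
    ⟨(b : ZMod (m * ℓ)).val / m, Nat.div_lt_of_lt_mul (ZMod.val_lt _)⟩
  have hJ : ∀ b, ((J b : Fin ℓ) : ℕ) = (b : ZMod (m * ℓ)).val / m := fun b => rfl
  have hmemS : ∀ b ∈ S, (b : ZMod (m * ℓ)).val = (a : ZMod m).val + m * (J b : ℕ) := by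
    intro b hb
    rw [hS, Finset.mem_filter] at hb
    have hcast : (ZMod.cast ((b : ZMod (m * ℓ))) : ZMod m) = (a : ZMod m) := by
      rw [← ZMod.unitsMap_val (dvd_mul_right m ℓ) b, hb.2]
    rw [hJ]
    exact (val_eq_add_mul_div_of_cast_eq hcast).1
  have hsum1 : ∑ b ∈ S, g (b : ZMod (m * ℓ)).val =
      ∑ b ∈ S, g ((a : ZMod m).val + m * (J b : ℕ)) :=
    Finset.sum_congr rfl fun b hb => by rw [hmemS b hb]
  have hinj : ∀ b ∈ S, ∀ b' ∈ S, J b = J b' → b = b' := by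
    intro b hb b' hb' hJbb
    have hv : (b : ZMod (m * ℓ)).val = (b' : ZMod (m * ℓ)).val := by
      rw [hmemS b hb, hmemS b' hb', show ((J b : Fin ℓ) : ℕ) = J b' from congr_arg Fin.val hJbb]
    exact Units.ext (ZMod.val_injective _ hv)
  have himage : S.image J = Finset.univ.erase ⟨j₀, hj₀lt⟩ := by
    ext j
    simp only [Finset.mem_image, Finset.mem_erase, Finset.mem_univ, and_true]
    constructor
    · rintro ⟨b, hb, rfl⟩ hJb
      have hval := hmemS b hb
      have hunit : IsUnit ((((a : ZMod m).val + m * (J b : ℕ) : ℕ)) : ZMod (m * ℓ)) := by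
        rw [← hval, ZMod.natCast_zmod_val]
        exact Units.isUnit b
      rw [isUnit_natCast_add_mul_iff hℓ hℓm a (J b).isLt] at hunit
      exact hunit (congr_arg Fin.val hJb)
    · intro hj
      have hj' : (j : ℕ) ≠ j₀ := fun h => hj (Fin.ext h)
      have hunit := (isUnit_natCast_add_mul_iff hℓ hℓm a j.isLt).mpr hj'
      refine ⟨hunit.unit, ?_, ?_⟩
      · rw [hS, Finset.mem_filter]
        refine ⟨Finset.mem_univ _, Units.ext ?_⟩
        rw [ZMod.unitsMap_val, IsUnit.unit_spec, cast_natCast_add_mul]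
      · apply Fin.ext
        rw [hJ, IsUnit.unit_spec, val_natCast_add_mul (ℓ := ℓ) (a : ZMod m) j,
          Nat.add_mul_div_left _ _ (Nat.pos_of_ne_zero (NeZero.ne m)),
          Nat.div_eq_of_lt (ZMod.val_lt _), zero_add]
  rw [hsum1, ← Finset.sum_image (f := fun j : Fin ℓ => g ((a : ZMod m).val + m * (j : ℕ))) hinj,
    himage, hj₀]
  exact Finset.sum_erase_add _ _ (Finset.mem_univ _)

end Fibres

/-! ### §B. The norm relation -/

section NormRelation

open CongruenceSubgroup

variable {N : ℕ} (f : CuspForm (Gamma0 N) 2) {m ℓ : ℕ} [NeZero m] [NeZero ℓ]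

omit [NeZero m] [NeZero ℓ] in
/-- The coefficients of the projected modular element:
`(π_* θ̃_f(n))_a = ∑_{b ∈ (ℤ/n)ˣ, b ↦ a} [b/n]⁺_f`. [folklore] -/
theorem coeff_mapDomain_unitsMap_modularElement {n : ℕ} [NeZero n] (h : m ∣ n) (a : (ZMod m)ˣ) :
    (MonoidAlgebra.mapDomain (ZMod.unitsMap h) (modularElement f n)).coeff a =
      ∑ b ∈ Finset.univ.filter (fun b : (ZMod n)ˣ => ZMod.unitsMap h b = a),
        ratPlusSymbol f (((b : ZMod n).val : ℚ) / n) := by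
  rw [modularElement, ← MonoidAlgebra.mapDomainRingHom_apply ℚ, map_sum, MonoidAlgebra.coeff_sum,
    Finsupp.finsetSum_apply, Finset.sum_filter]
  refine Finset.sum_congr rfl fun b _ => ?_
  rw [MonoidAlgebra.mapDomainRingHom_apply, MonoidAlgebra.mapDomain_single,
    MonoidAlgebra.coeff_single, Finsupp.single_apply]

omit [NeZero ℓ] in
/-- The coefficients of a translated modular element: `(r δ_g · θ̃_f(m))_a = r [g⁻¹a/m]⁺_f`.
[folklore] -/
theorem coeff_single_mul_modularElement (g a : (ZMod m)ˣ) (r : ℚ) :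
    (MonoidAlgebra.single g r * modularElement f m).coeff a =
      r * ratPlusSymbol f ((((g⁻¹ * a : (ZMod m)ˣ) : ZMod m).val : ℚ) / m) := by
  rw [MonoidAlgebra.coeff_single_mul_apply, coeff_modularElement]

omit [NeZero ℓ] in
/-- `[ℓ · a/m]⁺ = [(σ_ℓ a)/m]⁺`: multiplying the numerator by `ℓ` and reducing mod `m` changes the
argument of the `1`-periodic symbol `[·]⁺_f` by an integer (`ratPlusSymbol_add_intCast_eq`).
[folklore] -/
theorem ratPlusSymbol_mul_val_div [NeZero N] (hℓm : ℓ.Coprime m) (a : (ZMod m)ˣ) :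
    ratPlusSymbol f ((ℓ : ℚ) * (((a : ZMod m).val : ℚ) / m)) =
      ratPlusSymbol f ((((ZMod.unitOfCoprime ℓ hℓm * a : (ZMod m)ˣ) : ZMod m).val : ℚ) / m) := by
  have hm0 : (m : ℚ) ≠ 0 := by exact_mod_cast NeZero.ne m
  -- `ℓ · a.val = m q + (σ_ℓ a).val` with `q = ⌊ℓ a.val / m⌋`
  have hval : ((ZMod.unitOfCoprime ℓ hℓm * a : (ZMod m)ˣ) : ZMod m).val =
      (ℓ * (a : ZMod m).val) % m := by
    rw [Units.val_mul, ZMod.coe_unitOfCoprime, ZMod.val_mul, ZMod.val_natCast, Nat.mod_mul_mod]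
  have hdiv := Nat.div_add_mod (ℓ * (a : ZMod m).val) m
  rw [← hval] at hdiv
  set q : ℕ := ℓ * (a : ZMod m).val / m with hq
  have hnat : (m : ℚ) * q + (((ZMod.unitOfCoprime ℓ hℓm * a : (ZMod m)ˣ) : ZMod m).val : ℚ) =
      (ℓ : ℚ) * ((a : ZMod m).val : ℚ) := by
    exact_mod_cast hdiv
  have hrat : (ℓ : ℚ) * (((a : ZMod m).val : ℚ) / m) =
      ((((ZMod.unitOfCoprime ℓ hℓm * a : (ZMod m)ˣ) : ZMod m).val : ℚ) / m) + ((q : ℤ) : ℚ) := by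
    rw [Int.cast_natCast]
    field_simp
    linear_combination (-1 : ℚ) * hnat
  rw [hrat, ratPlusSymbol_add_intCast_eq]

/-- **The norm relation of the Mazur–Tate modular elements** (Ota 2018, Prop. 2.3 (1)-type;
Mazur–Tate 1987, §1): for a prime `ℓ` with `gcd(ℓ, m) = 1`, the projection of `θ̃_f(mℓ)` along
`(ℤ/mℓ)ˣ → (ℤ/m)ˣ` is `(a_ℓ - σ_ℓ - σ_ℓ⁻¹) · θ̃_f(m)` in `ℚ[(ℤ/m)ˣ]`, `σ_ℓ` the class of `ℓ`, GIVEN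
the Hecke relation of the rational plus symbols at `ℓ` with eigenvalue `a_ℓ` (`hHecke`; for a
rational newform and `ℓ ∤ N` this is the tree theorem `ModularForms.intCast_mul_ratPlusSymbol`, see
`mapDomain_unitsMap_modularElement`). Coefficientwise: the units of `ℤ/mℓ` over `a ∈ (ℤ/m)ˣ` are
the classes `a + m j`, `j < ℓ`, except `a + m j₀ = ℓ (σ_ℓ⁻¹ a)`, and
`∑_{j < ℓ} [(a + m j)/(mℓ)]⁺ = ∑_{j mod ℓ} [(a/m + j)/ℓ]⁺ = a_ℓ [a/m]⁺ - [ℓ a/m]⁺`.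
[cite: Ota2018, Prop. 2.3 (1)] -/
theorem mapDomain_unitsMap_modularElement_of_hecke [NeZero N] (hℓ : ℓ.Prime) (hℓm : ℓ.Coprime m) {aℓ : ℤ}
    (hHecke : ∀ r : ℚ, (aℓ : ℚ) * ratPlusSymbol f r =
      ∑ j : Fin ℓ, ratPlusSymbol f ((r + j) / ℓ) + ratPlusSymbol f (ℓ * r)) :
    MonoidAlgebra.mapDomain (ZMod.unitsMap (dvd_mul_right m ℓ)) (modularElement f (m * ℓ)) =
      (MonoidAlgebra.single 1 (aℓ : ℚ) - MonoidAlgebra.single (ZMod.unitOfCoprime ℓ hℓm) 1 -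
          MonoidAlgebra.single (ZMod.unitOfCoprime ℓ hℓm)⁻¹ 1) * modularElement f m := by
  apply MonoidAlgebra.ext
  ext a
  rw [coeff_mapDomain_unitsMap_modularElement, sub_mul, sub_mul, MonoidAlgebra.coeff_sub,
    MonoidAlgebra.coeff_sub, Finsupp.sub_apply, Finsupp.sub_apply,
    coeff_single_mul_modularElement, coeff_single_mul_modularElement,
    coeff_single_mul_modularElement, inv_one, one_mul, one_mul, one_mul, inv_inv]
  have hm0 : (m : ℚ) ≠ 0 := by exact_mod_cast NeZero.ne m
  have hℓ0 : (ℓ : ℚ) ≠ 0 := by exact_mod_cast NeZero.ne ℓ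
  -- the fibre count of §B with `g t = [t/(mℓ)]⁺`
  have key := sum_filter_unitsMap_add_eq_sum_fin hℓ hℓm
    (fun t : ℕ => ratPlusSymbol f ((t : ℚ) / (m * ℓ : ℕ))) a
  -- the non-unit term is `[(σ_ℓ⁻¹ a)/m]⁺`
  have hnu : ratPlusSymbol f (((ℓ * (((ZMod.unitOfCoprime ℓ hℓm)⁻¹ * a : (ZMod m)ˣ) : ZMod m).val :
      ℕ) : ℚ) / (m * ℓ : ℕ)) =
      ratPlusSymbol f (((((ZMod.unitOfCoprime ℓ hℓm)⁻¹ * a : (ZMod m)ˣ) : ZMod m).val : ℚ) / m) := by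
    congr 1
    push_cast
    field_simp
  -- the Hecke relation at `r = a/m`, with `(a/m + j)/ℓ = (a + m j)/(mℓ)`
  have hH := hHecke (((a : ZMod m).val : ℚ) / m)
  have hsum : ∑ j : Fin ℓ, ratPlusSymbol f (((((a : ZMod m).val : ℚ) / m) + j) / ℓ) =
      ∑ j : Fin ℓ, ratPlusSymbol f ((((a : ZMod m).val + m * (j : ℕ) : ℕ) : ℚ) / (m * ℓ : ℕ)) := by
    refine Finset.sum_congr rfl fun j _ => ?_
    congr 1
    push_cast
    field_simp
  rw [hsum, ← key, hnu, ratPlusSymbol_mul_val_div f hℓm] at hH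
  linear_combination (-1 : ℚ) * hH

/-- **The norm relation, hypothesis-free form** for a normalised newform `f ∈ S₂(Γ₀(N))` with
rational Fourier coefficients and a prime `ℓ ∤ N` with `gcd(ℓ, m) = 1`, `a_ℓ(f) = a_ℓ ∈ ℤ`:
`π_* θ̃_f(mℓ) = (a_ℓ - σ_ℓ - σ_ℓ⁻¹) · θ̃_f(m)` — `mapDomain_unitsMap_modularElement_of_hecke` with
the Hecke relation supplied by the tree theorems `ModularForms.intCast_mul_ratPlusSymbol`
(Mazur–Tate–Teitelbaum 1986, §I.4 (4.2)) and `ratCast_ratPlusSymbol_holds` (§I.8).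
[cite: Ota2018, Prop. 2.3 (1)] -/
theorem mapDomain_unitsMap_modularElement [NeZero N] {f : CuspForm (Gamma0 N) 2}
    (hf : IsNewform0 f) (hQ : coeffField f = ⊥) (hℓ : ℓ.Prime) (hℓN : ¬ ℓ ∣ N)
    (hℓm : ℓ.Coprime m) {aℓ : ℤ} (haℓ : cuspCoeff f ℓ = aℓ) :
    MonoidAlgebra.mapDomain (ZMod.unitsMap (dvd_mul_right m ℓ)) (modularElement f (m * ℓ)) =
      (MonoidAlgebra.single 1 (aℓ : ℚ) - MonoidAlgebra.single (ZMod.unitOfCoprime ℓ hℓm) 1 -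
          MonoidAlgebra.single (ZMod.unitOfCoprime ℓ hℓm)⁻¹ 1) * modularElement f m :=
  mapDomain_unitsMap_modularElement_of_hecke f hℓ hℓm fun r =>
    intCast_mul_ratPlusSymbol ℓ hf hℓ hℓN haℓ (ratCast_ratPlusSymbol_holds hf hQ) r

end NormRelation

end Summit.BirchSwinnertonDyer.Rank1Residual.GaloisImage

end
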